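import Mathlib
import HarnessLib
import Summits.HubbardSuperconductivity.HubbardSuperconductivity.Theorems.KLProgrammeKLRegimeEngineV17F2RowBOfE1Data3LB
import Summits.HubbardSuperconductivity.HubbardSuperconductivity.Theorems.KLProgrammeKLRegimeEngineIsoLineFromPlainWtCut

/-!
# Route `KLProgramme` — ENGINE (stmt-HubbardSuperconductivity-20437 `KLRegimeEngineV17F2`), ROW (b): CURE (α) OF LOCATED #25 «(b)-PLAIN-UV-TAIL», LINK 3 —
# the row-(b) closer with the `hplainE1` binder (#6) RE-KEYED to the UV-CUT plain line (pen (R669): cure of record (α), build authorised; lead k3c2-p2 g33)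

Verbatim twin of `…RowBOfE1Data3LB` (p3/k3c2-p2; the ★ v19/v20 slot-(b) reader `A24a1G14.stub_engine_step_norms_of_E1data₃LB hE₁ ha hb hu₀ hplainE1 hincr′`) in which
the `hplainE1` binder's PLAIN position-space quartic line is stated for the leg-rescaled element `map (mulLeft ĝ) 𝒱ₙ[Kₙ]`, `ĝ((k,σ),c) = gnScaleCutoff 4 klE0 1 |ω_k|`
(smooth one-sector UV cut in the frequency, ≡ 1 for `|ω| ≤ klE0` — absorbed by every sector family of the programme), instead of for `𝒱ₙ[Kₙ]` itself (whose plain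
line contains the integer-truncation tail of the tree's bare vertex, located #25, ✓ p765343).  Its two consumers are the cut twins `e4FlowAt_of_wplainLine_flow_deep_cut`
(✓ LINK 1) and `isoMomFlowAt_of_wplainLine_isoSingle_cut` (✓ LINK 2); `hE₁`, `hincr′` are UNCHANGED (binder #5's (E4) conjunct is cured by LINK 4, `hW_of_numW4_cut`,
not here).  Conclusion = row (b) VERBATIM.
* `stub_engine_step_norms_of_E1dataLBcut6`, **`A24a1G14.stub_engine_step_norms_of_E1data₃LBcut6 hE₁ ha hb hu₀ hplainE1cut hincr′`** ⊢ row (b).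
Bookkeeping only; every binder is a HYPOTHESIS; nothing here asserts any of them, row (b), any stub of 20437, K3, U₀, the window or superconductivity; the fold (if any) is
the registrant's and the pen's.  References: BGM 2006 §2.5–§2.8 (2.52)–(2.84), Lemma 2.5 (2.98), §3 (3.2)–(3.8) [cite: BenfattoGiulianiMastropietro2006].
-/

noncomputable section

namespace Summit.HubbardSuperconductivity.HubbardSuperconductivity.Theorems.EngineV8.A24a1G14

set_option linter.dupNamespace false -- summit = problem name (single-conjunct summit), D-0017

open Classical
open Real Finset Literature.MathematicalPhysics.QuantumLattice Literature.Probability.LatticeModels GrassmannAlgebra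
open Literature.MathematicalPhysics.QuantumLattice.FermiRG
open Summit.HubbardSuperconductivity.HubbardSuperconductivity.Theorems.KLProgrammeLegKernels
open Summit.HubbardSuperconductivity.HubbardSuperconductivity.Theorems.KLRegimeSplit
open Summit.HubbardSuperconductivity.HubbardSuperconductivity.Theorems.DispersionFlow
open Summit.HubbardSuperconductivity.HubbardSuperconductivity.Theorems.EngineV8

/-- **ROW (b) FROM E1 / GEOMETRY DATA, LOCAL-BLIND INCREMENT CURRENCY, WITH THE `hplainE1` BINDER UV-CUT (cure (α) of located #25, binder #6)** — (twin of `stub_engine_step_norms_of_E1data` with `hincr` ↦ the `(klScaleWt − 1)`-weighted family, composed through `exists_gridLitPkg_of_momIncrements`) — `hE₁` (E1's (E2)∧(E4)∧(E6) family), `hplainE1` (the U-currency weighted plain quartic line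
family, shared by `hE4` and `hexI`), `hisoW` (the weighted iso single character sums), `hincr` (the weighted two-leg slice-increment masses); one application of
`stub_engine_step_norms_of_E1rows` to the three by-type witnesses. [cite: BenfattoGiulianiMastropietro2006, §2.7-§2.8 (2.66)-(2.84), Lemma 2.5 (2.98), §3 (3.2)-(3.8)] -/
theorem stub_engine_step_norms_of_E1dataLBcut6
    (hE₁ : ∀ (P : SplitConsts) (R : RenConsts), P.WF → R.WF2 →
      ∃ s₂u s₂c s₄ S₆ : ℝ, 0 ≤ s₂u ∧ 0 ≤ s₂c ∧ 0 ≤ s₄ ∧ 0 ≤ S₆ ∧ ∃ cE UE : ℝ, 0 < cE ∧ 0 < UE ∧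
      ∀ (Q : EngConsts) (cc : ℝ), 0 < cc → cc ≤ klEngC₃6 P R → cc ≤ cE →
      ∀ μ ∈ klWindowC, ∀ U : ℝ, 0 < U → U ≤ klEngU₀10 P R cc → U ≤ UE →
      ∀ β : ℝ, klBetaMin ≤ β → β ≤ Real.exp (cc / U ^ 2) →
      ∀ (L M : ℕ) [NeZero L] [NeZero M], klEngL₄ P R β U ≤ L → klEngM₃ β U L ≤ M →
      ∀ n : ℕ, 1 ≤ n → n ≤ nScales β + 1 → IsKLRegime U cc (-(n : ℤ)) →
      HistP klPredsV17F2 L M klEngGeo14 P Q R β U μ 0 n →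
      (∀ m, 1 ≤ m → m < n → FlowPieceOscAt L M (klReadOscC P R) β U μ m) →
      FrameOK R U (nScales β) μ (klFlowFrameU L M β U μ n) →
      (∀ j ≤ n, LevelsUExportMixedAt L M (klCU2 P R (klEngQ7 P R)) P β U μ j) →
      (∀ i, 1 ≤ i → i ≤ n → ∀ (q : Fin 2) (w : SpaceTimeIdx L M × SectorLeg (sectorCount (i - 1))),
        klWtPinnedSumOf L M β μ (klFlowFrameU L M β U μ n) (i - 1) 2 (klEffectiveAction L M β U μ (klFlowFrameU L M β U μ n) klE0 i) q w ≤
          (s₂u * |U| + s₂c * cc) * ((4 : ℝ) ^ (i - 1))⁻¹) ∧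
      (∀ i, 1 ≤ i → i ≤ n → ∀ (q : Fin 4) (τ' : Fin 4 → SectorLeg 1) (y' : SpaceTimeIdx L M),
        imagTimeWeight β M ^ 3 * ∑ x' ∈ univ.filter (fun x' : Fin 4 → SpaceTimeIdx L M => x' q = y'),
          klScaleWt L M β i ((univ.image x').image (fun x : SpaceTimeIdx L M => (((((2 * (x.1 : ℕ) : ℕ)) : ZMod (2 * (2 * M)))), x.2))) *
            ‖sectorisedKernel L M β (trivialMultiplier L M) (klEffectiveAction L M β U μ (klFlowFrameU L M β U μ n) klE0 i) 4 τ' x'‖ ≤ s₄ * epsCoupling P U i) ∧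
      (∀ i, 1 ≤ i → i ≤ n → ∀ (q : Fin 6) (w : SpaceTimeIdx L M × SectorLeg (sectorCount (i - 1))),
        klWtPinnedSumOf L M β μ (klFlowFrameU L M β U μ n) (i - 1) 6 (klEffectiveAction L M β U μ (klFlowFrameU L M β U μ n) klE0 i) q w ≤
          S₆ * epsCoupling P U i ^ 2 * (2 : ℝ) ^ (4 * i)))
    {a T_I : ℝ} (ha : 0 ≤ a) (hTI : 0 ≤ T_I) {bfun u₀ : GeoConsts → SplitConsts → RenConsts → EngConsts → ℝ → ℝ}
    (hb : ∀ G P R Q cc, 0 ≤ bfun G P R Q cc) (hu₀ : ∀ G P R Q cc, 0 < u₀ G P R Q cc)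
    (hplainE1 : ∀ (G : GeoConsts), G.WF → ∀ (P : SplitConsts) (R : RenConsts) (Q : EngConsts) (cc : ℝ), P.WF → R.WF2 → Q.WF → 0 < cc →
      cc ≤ klEngC₃6 P R → ∀ μ ∈ klWindowC, ∀ U : ℝ, 0 < U → U ≤ u₀ G P R Q cc →
      ∀ β : ℝ, klBetaMin ≤ β → β ≤ Real.exp (cc / U ^ 2) →
      ∀ (L M : ℕ) [NeZero L] [NeZero M], klEngL₃ β U ≤ L → klEngM₃ β U L ≤ M →
      ∀ n : ℕ, 1 ≤ n → n ≤ nScales β + 1 → IsKLRegime U cc (-(n : ℤ)) →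
        HistP klPredsV17F2 L M G P Q R β U μ 0 n → FrameOK R U (nScales β) μ (klFlowFrameU L M β U μ n) →
        ∀ (τ' : Fin 4 → SectorLeg 1) (y : SpaceTimeIdx L M),
          imagTimeWeight β M ^ 3 * ∑ x' ∈ univ.filter (fun x' : Fin 4 → SpaceTimeIdx L M => x' 0 = y),
            klScaleWt L M β n ((univ.image x').image (fun x : SpaceTimeIdx L M => (((((2 * (x.1 : ℕ) : ℕ)) : ZMod (2 * (2 * M)))), x.2))) *
              ‖sectorisedKernel L M β (trivialMultiplier L M)
                (ExteriorAlgebra.map (LinearMap.mulLeft ℂ (fun K : HubbardFieldIdx L M => ((gnScaleCutoff 4 klE0 1 |matsubaraFreq β M K.1.1.1| : ℝ) : ℂ)))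
                  (klEffectiveAction L M β U μ (klFlowFrameU L M β U μ n) klE0 n)) 4 τ' x'‖ ≤
          klE0 * (a * |U| + bfun G P R Q cc * (P.Klam * U) ^ 2))
    (hisoW : ∀ (G : GeoConsts), G.WF → ∀ (P : SplitConsts) (R : RenConsts) (Q : EngConsts) (cc : ℝ), P.WF → R.WF2 → Q.WF → 0 < cc →
      cc ≤ klEngC₃6 P R → ∀ μ ∈ klWindowC, ∀ U : ℝ, 0 < U → U ≤ u₀ G P R Q cc →
      ∀ β : ℝ, klBetaMin ≤ β → β ≤ Real.exp (cc / U ^ 2) →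
      ∀ (L M : ℕ) [NeZero L] [NeZero M], klEngL₃ β U ≤ L → klEngM₃ β U L ≤ M →
      ∀ n : ℕ, 1 ≤ n → n ≤ nScales β + 1 → IsKLRegime U cc (-(n : ℤ)) →
        HistP klPredsV17F2 L M G P Q R β U μ 0 n → FrameOK R U (nScales β) μ (klFlowFrameU L M β U μ n) →
        ∀ m, n ≤ m → m ≤ nScales β → ∀ σ : Fin (sectorCount (2 * m)),
          ∑ z : TorusSite 1 (2 * M) × TorusSite 2 L,
            (1 + klScale klE0 m * β / (2 * M) * |(((z.1 0).valMinAbs : ℤ) : ℝ)| + klScale klE0 m * |(((z.2 0).valMinAbs : ℤ) : ℝ)| +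
                klScale klE0 m * |(((z.2 1).valMinAbs : ℤ) : ℝ)|) *
            ‖∑ q : TorusSite 1 (2 * M) × TorusSite 2 L, (torusChar q.1 z.1 * torusChar q.2 z.2) •
              klIsoFamily L M β μ (klFlowFrameU L M β U μ n) klE0 m σ (⟨(q.1 0).val, ZMod.val_lt (q.1 0)⟩, q.2)‖ ≤ T_I * M * (L : ℝ) ^ 2)
    (hincr : ∀ (P : SplitConsts) (R : RenConsts), P.WF → R.WF2 →
      ∃ Bw : ℝ, 0 ≤ Bw ∧ ∃ uI : EngConsts → ℝ → ℝ, (∀ Q cc, 0 < uI Q cc) ∧ ∃ cI : ℝ, 0 < cI ∧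
      ∀ Q : EngConsts, (klEngQ7 P R).IsRaiseOf Q →
      ∀ cc : ℝ, 0 < cc → cc ≤ klEngC₃6 P R → cc ≤ cI →
      ∀ μ ∈ klWindowC, ∀ U : ℝ, 0 < U → U ≤ klEngU₀10 P R cc → U ≤ uI Q cc →
      ∀ β : ℝ, klBetaMin ≤ β → β ≤ Real.exp (cc / U ^ 2) →
      ∀ (L M : ℕ) [NeZero L] [NeZero M], klEngL₄ P R β U ≤ L → klEngM₃ β U L ≤ M →
      ∀ n : ℕ, 1 ≤ n → n ≤ nScales β + 1 →
        HistP klPredsV17F2 L M klEngGeo14 P Q R β U μ 0 n → FrameOK R U (nScales β) μ (klFlowFrameU L M β U μ n) →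
        ∃ b : ℕ → ℝ, (∑ j ∈ range n, (klScale klE0 (j + 1))⁻¹ * b j ≤ Bw) ∧
          ∀ j < n, ∀ w : GridLeg (GridPoint L (2 * (2 * M))),
            ∑ Y ∈ univ.filter (fun Y : Fin 2 → GridLeg (GridPoint L (2 * (2 * M))) => Y 0 = w),
              (klScaleWt L M β (j + 1) ((univ.image Y).image gridLegPos) - 1) *
                ‖kernel ℂ
                  (effAction ℂ ((hubbardGridSub L M β (2 * (2 * M))).transpose *
                      hubbardCovAboveCT L M β μ 0 (klFlowFrameU L M β U μ n) (klScale klE0 (j + 1)) * hubbardGridSub L M β (2 * (2 * M)))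
                    (hubbardGridInteraction L (2 * (2 * M)) β U + hubbardGridCounterQuadratic L (2 * (2 * M)) β (klFlowFrameU L M β U μ n)) -
                  effAction ℂ ((hubbardGridSub L M β (2 * (2 * M))).transpose *
                      hubbardCovAboveCT L M β μ 0 (klFlowFrameU L M β U μ n) (klScale klE0 j) * hubbardGridSub L M β (2 * (2 * M)))
                    (hubbardGridInteraction L (2 * (2 * M)) β U + hubbardGridCounterQuadratic L (2 * (2 * M)) β (klFlowFrameU L M β U μ n))) 2 Y‖ ≤
              b j * U ^ 2 * (β / (2 * ((2 * (2 * M) : ℕ) : ℝ)))) :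
    ∀ (P : SplitConsts) (R : RenConsts) (c : ℝ), P.WF → R.WF2 → 0 < c → c ≤ klEngC₃7GU klEngGeo14 P R →
      ∀ μ ∈ klWindowC, ∀ U : ℝ, 0 < U → U ≤ klEngU₀12GQ klEngGeo14 (klEngQ9dG klEngGeo14 P R) P R c → ∀ β : ℝ, klBetaMin ≤ β → β ≤ Real.exp (c / U ^ 2) →
        ∀ (L M : ℕ) [NeZero L] [NeZero M], klEngL₄ P R β U ≤ L → klEngM₃ β U L ≤ M →
          ∀ n : ℕ, 1 ≤ n → n ≤ nScales β + 1 → IsKLRegime U c (-(n : ℤ)) →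
            HistP klPredsV17F2 L M klEngGeo14 P (klEngQ9dG klEngGeo14 P R) R β U μ 0 n →
              (∀ m, 1 ≤ m → m < n → FlowPieceOscAt L M (klReadOscC P R) β U μ m) →
              FrameOK R U (nScales β) μ (klFlowFrameU L M β U μ n) →
                (∀ j ≤ n, LevelsUExportMixedAt L M (klCU2 P R (klEngQ7 P R)) P β U μ j) →
                  KernelNormsV4 L M P (klEngQ9dG klEngGeo14 P R) β U μ (klFlowFrameU L M β U μ n) n ∧
                    (∀ j ≤ n, (KernelNormsLevels L M P (klEngQ9dG klEngGeo14 P R) β U μ (klFlowFrameU L M β U μ n) j ∧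
                      KernelNormsWt4 L M (klWtBudget P (klEngQ9dG klEngGeo14 P R) U j) β U μ (klFlowFrameU L M β U μ n) j)) ∧
                    EngineFirstMoments L M klEngGeo14 P (klEngQ9dG klEngGeo14 P R) β U μ (klFlowFrameU L M β U μ n) n ∧
                    IsoFirstMomentsAt L M klIsoMomC (klIsoMomD P R) P β U μ n ∧
                    TwoLegGridFlowMomentsAtC L M (klZtG klEngGeo14 P R) (klZs1G klEngGeo14 P R) (klZs2G klEngGeo14 P R) c β U μ n :=
  stub_engine_step_norms_of_E1rows hE₁ (e4FlowAt_of_wplainLine_flow_deep_cut ha hb hu₀ hplainE1)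
    (isoMomFlowAt_of_wplainLine_isoSingle_cut ha hTI hb hu₀ hplainE1 hisoW) (exists_gridLitPkg_of_momIncrements hincr)

/-- **ROW (b) FROM E1-CLASS DATA ONLY, LOCAL-BLIND INCREMENT CURRENCY, `hplainE1` UV-CUT (cure (α) of located #25, binder #6; candidate pin slot (b) `…_of_E1data₃LBcut6 hE₁ ha hb hu₀ hplainE1cut hincr′`)** — (twin of `stub_engine_step_norms_of_E1data₃`: the binder `hincr` weighs the two-leg slice increments by `klScaleWt − 1 = Λ·diam` — cure (α′) of the located candidate «(b)-HINCR-TADPOLE»; candidate pin slot (b) `…_of_E1data₃LB hE₁ ha hb hu₀ hplainE1 hincr`) — `hE₁` (E1's (E2)∧(E4)∧(E6) family), `hplainE1` (the U-currency weighted plain quartic line family,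
shared by `hE4` and `hexI`), `hincr` (the weighted two-leg slice-increment masses); the geometry datum `hisoW` is SUPPLIED by `isoTorusSumWt_flow_uniform` at the
threshold `u₀ ⊓ klEngU₀3 ⊓ 1/(|Gfr₃|+1)`. [cite: BenfattoGiulianiMastropietro2006, §2.5-§2.8 (2.52)-(2.84), Lemma 2.5 (2.98), §3 (3.2)-(3.8)] -/
theorem stub_engine_step_norms_of_E1data₃LBcut6
    (hE₁ : ∀ (P : SplitConsts) (R : RenConsts), P.WF → R.WF2 →
      ∃ s₂u s₂c s₄ S₆ : ℝ, 0 ≤ s₂u ∧ 0 ≤ s₂c ∧ 0 ≤ s₄ ∧ 0 ≤ S₆ ∧ ∃ cE UE : ℝ, 0 < cE ∧ 0 < UE ∧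
      ∀ (Q : EngConsts) (cc : ℝ), 0 < cc → cc ≤ klEngC₃6 P R → cc ≤ cE →
      ∀ μ ∈ klWindowC, ∀ U : ℝ, 0 < U → U ≤ klEngU₀10 P R cc → U ≤ UE →
      ∀ β : ℝ, klBetaMin ≤ β → β ≤ Real.exp (cc / U ^ 2) →
      ∀ (L M : ℕ) [NeZero L] [NeZero M], klEngL₄ P R β U ≤ L → klEngM₃ β U L ≤ M →
      ∀ n : ℕ, 1 ≤ n → n ≤ nScales β + 1 → IsKLRegime U cc (-(n : ℤ)) →
      HistP klPredsV17F2 L M klEngGeo14 P Q R β U μ 0 n →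
      (∀ m, 1 ≤ m → m < n → FlowPieceOscAt L M (klReadOscC P R) β U μ m) →
      FrameOK R U (nScales β) μ (klFlowFrameU L M β U μ n) →
      (∀ j ≤ n, LevelsUExportMixedAt L M (klCU2 P R (klEngQ7 P R)) P β U μ j) →
      (∀ i, 1 ≤ i → i ≤ n → ∀ (q : Fin 2) (w : SpaceTimeIdx L M × SectorLeg (sectorCount (i - 1))),
        klWtPinnedSumOf L M β μ (klFlowFrameU L M β U μ n) (i - 1) 2 (klEffectiveAction L M β U μ (klFlowFrameU L M β U μ n) klE0 i) q w ≤
          (s₂u * |U| + s₂c * cc) * ((4 : ℝ) ^ (i - 1))⁻¹) ∧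
      (∀ i, 1 ≤ i → i ≤ n → ∀ (q : Fin 4) (τ' : Fin 4 → SectorLeg 1) (y' : SpaceTimeIdx L M),
        imagTimeWeight β M ^ 3 * ∑ x' ∈ univ.filter (fun x' : Fin 4 → SpaceTimeIdx L M => x' q = y'),
          klScaleWt L M β i ((univ.image x').image (fun x : SpaceTimeIdx L M => (((((2 * (x.1 : ℕ) : ℕ)) : ZMod (2 * (2 * M)))), x.2))) *
            ‖sectorisedKernel L M β (trivialMultiplier L M) (klEffectiveAction L M β U μ (klFlowFrameU L M β U μ n) klE0 i) 4 τ' x'‖ ≤ s₄ * epsCoupling P U i) ∧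
      (∀ i, 1 ≤ i → i ≤ n → ∀ (q : Fin 6) (w : SpaceTimeIdx L M × SectorLeg (sectorCount (i - 1))),
        klWtPinnedSumOf L M β μ (klFlowFrameU L M β U μ n) (i - 1) 6 (klEffectiveAction L M β U μ (klFlowFrameU L M β U μ n) klE0 i) q w ≤
          S₆ * epsCoupling P U i ^ 2 * (2 : ℝ) ^ (4 * i)))
    {a : ℝ} (ha : 0 ≤ a) {bfun u₀ : GeoConsts → SplitConsts → RenConsts → EngConsts → ℝ → ℝ}
    (hb : ∀ G P R Q cc, 0 ≤ bfun G P R Q cc) (hu₀ : ∀ G P R Q cc, 0 < u₀ G P R Q cc)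
    (hplainE1 : ∀ (G : GeoConsts), G.WF → ∀ (P : SplitConsts) (R : RenConsts) (Q : EngConsts) (cc : ℝ), P.WF → R.WF2 → Q.WF → 0 < cc →
      cc ≤ klEngC₃6 P R → ∀ μ ∈ klWindowC, ∀ U : ℝ, 0 < U → U ≤ u₀ G P R Q cc →
      ∀ β : ℝ, klBetaMin ≤ β → β ≤ Real.exp (cc / U ^ 2) →
      ∀ (L M : ℕ) [NeZero L] [NeZero M], klEngL₃ β U ≤ L → klEngM₃ β U L ≤ M →
      ∀ n : ℕ, 1 ≤ n → n ≤ nScales β + 1 → IsKLRegime U cc (-(n : ℤ)) →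
        HistP klPredsV17F2 L M G P Q R β U μ 0 n → FrameOK R U (nScales β) μ (klFlowFrameU L M β U μ n) →
        ∀ (τ' : Fin 4 → SectorLeg 1) (y : SpaceTimeIdx L M),
          imagTimeWeight β M ^ 3 * ∑ x' ∈ univ.filter (fun x' : Fin 4 → SpaceTimeIdx L M => x' 0 = y),
            klScaleWt L M β n ((univ.image x').image (fun x : SpaceTimeIdx L M => (((((2 * (x.1 : ℕ) : ℕ)) : ZMod (2 * (2 * M)))), x.2))) *
              ‖sectorisedKernel L M β (trivialMultiplier L M)
                (ExteriorAlgebra.map (LinearMap.mulLeft ℂ (fun K : HubbardFieldIdx L M => ((gnScaleCutoff 4 klE0 1 |matsubaraFreq β M K.1.1.1| : ℝ) : ℂ)))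
                  (klEffectiveAction L M β U μ (klFlowFrameU L M β U μ n) klE0 n)) 4 τ' x'‖ ≤
          klE0 * (a * |U| + bfun G P R Q cc * (P.Klam * U) ^ 2))
    (hincr : ∀ (P : SplitConsts) (R : RenConsts), P.WF → R.WF2 →
      ∃ Bw : ℝ, 0 ≤ Bw ∧ ∃ uI : EngConsts → ℝ → ℝ, (∀ Q cc, 0 < uI Q cc) ∧ ∃ cI : ℝ, 0 < cI ∧
      ∀ Q : EngConsts, (klEngQ7 P R).IsRaiseOf Q →
      ∀ cc : ℝ, 0 < cc → cc ≤ klEngC₃6 P R → cc ≤ cI →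
      ∀ μ ∈ klWindowC, ∀ U : ℝ, 0 < U → U ≤ klEngU₀10 P R cc → U ≤ uI Q cc →
      ∀ β : ℝ, klBetaMin ≤ β → β ≤ Real.exp (cc / U ^ 2) →
      ∀ (L M : ℕ) [NeZero L] [NeZero M], klEngL₄ P R β U ≤ L → klEngM₃ β U L ≤ M →
      ∀ n : ℕ, 1 ≤ n → n ≤ nScales β + 1 →
        HistP klPredsV17F2 L M klEngGeo14 P Q R β U μ 0 n → FrameOK R U (nScales β) μ (klFlowFrameU L M β U μ n) →
        ∃ b : ℕ → ℝ, (∑ j ∈ range n, (klScale klE0 (j + 1))⁻¹ * b j ≤ Bw) ∧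
          ∀ j < n, ∀ w : GridLeg (GridPoint L (2 * (2 * M))),
            ∑ Y ∈ univ.filter (fun Y : Fin 2 → GridLeg (GridPoint L (2 * (2 * M))) => Y 0 = w),
              (klScaleWt L M β (j + 1) ((univ.image Y).image gridLegPos) - 1) *
                ‖kernel ℂ
                  (effAction ℂ ((hubbardGridSub L M β (2 * (2 * M))).transpose *
                      hubbardCovAboveCT L M β μ 0 (klFlowFrameU L M β U μ n) (klScale klE0 (j + 1)) * hubbardGridSub L M β (2 * (2 * M)))
                    (hubbardGridInteraction L (2 * (2 * M)) β U + hubbardGridCounterQuadratic L (2 * (2 * M)) β (klFlowFrameU L M β U μ n)) -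
                  effAction ℂ ((hubbardGridSub L M β (2 * (2 * M))).transpose *
                      hubbardCovAboveCT L M β μ 0 (klFlowFrameU L M β U μ n) (klScale klE0 j) * hubbardGridSub L M β (2 * (2 * M)))
                    (hubbardGridInteraction L (2 * (2 * M)) β U + hubbardGridCounterQuadratic L (2 * (2 * M)) β (klFlowFrameU L M β U μ n))) 2 Y‖ ≤
              b j * U ^ 2 * (β / (2 * ((2 * (2 * M) : ℕ) : ℝ)))) :
    ∀ (P : SplitConsts) (R : RenConsts) (c : ℝ), P.WF → R.WF2 → 0 < c → c ≤ klEngC₃7GU klEngGeo14 P R →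
      ∀ μ ∈ klWindowC, ∀ U : ℝ, 0 < U → U ≤ klEngU₀12GQ klEngGeo14 (klEngQ9dG klEngGeo14 P R) P R c → ∀ β : ℝ, klBetaMin ≤ β → β ≤ Real.exp (c / U ^ 2) →
        ∀ (L M : ℕ) [NeZero L] [NeZero M], klEngL₄ P R β U ≤ L → klEngM₃ β U L ≤ M →
          ∀ n : ℕ, 1 ≤ n → n ≤ nScales β + 1 → IsKLRegime U c (-(n : ℤ)) →
            HistP klPredsV17F2 L M klEngGeo14 P (klEngQ9dG klEngGeo14 P R) R β U μ 0 n →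
              (∀ m, 1 ≤ m → m < n → FlowPieceOscAt L M (klReadOscC P R) β U μ m) →
              FrameOK R U (nScales β) μ (klFlowFrameU L M β U μ n) →
                (∀ j ≤ n, LevelsUExportMixedAt L M (klCU2 P R (klEngQ7 P R)) P β U μ j) →
                  KernelNormsV4 L M P (klEngQ9dG klEngGeo14 P R) β U μ (klFlowFrameU L M β U μ n) n ∧
                    (∀ j ≤ n, (KernelNormsLevels L M P (klEngQ9dG klEngGeo14 P R) β U μ (klFlowFrameU L M β U μ n) j ∧
                      KernelNormsWt4 L M (klWtBudget P (klEngQ9dG klEngGeo14 P R) U j) β U μ (klFlowFrameU L M β U μ n) j)) ∧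
                    EngineFirstMoments L M klEngGeo14 P (klEngQ9dG klEngGeo14 P R) β U μ (klFlowFrameU L M β U μ n) n ∧
                    IsoFirstMomentsAt L M klIsoMomC (klIsoMomD P R) P β U μ n ∧
                    TwoLegGridFlowMomentsAtC L M (klZtG klEngGeo14 P R) (klZs1G klEngGeo14 P R) (klZs2G klEngGeo14 P R) c β U μ n := by
  obtain ⟨T_I, hTI, hW⟩ := TorusFourierL2.isoTorusSumWt_flow_uniform
  refine stub_engine_step_norms_of_E1dataLBcut6 hE₁ ha hTI hb
    (u₀ := fun G P R Q cc => min (u₀ G P R Q cc) (min (klEngU₀3 P R cc) (1 / (|R.Gfr 3| + 1))))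
    (fun G P R Q cc => lt_min (hu₀ G P R Q cc) (lt_min (klEngU₀3_pos P R cc) (by positivity))) ?_ ?_ hincr
  · intro G hG P R Q cc hP hR hQ hcc hcc6 μ hμ U hU hUu β hβ hβc L M _ _ hL hM n hn1 hn hreg hhist hfr
    exact hplainE1 G hG P R Q cc hP hR hQ hcc hcc6 μ hμ U hU (hUu.trans (min_le_left _ _)) β hβ hβc L M hL hM n hn1 hn hreg hhist hfr
  · intro G hG P R Q cc hP hR hQ hcc hcc6 μ hμ U hU hUu β hβ hβc L M _ _ hL hM n hn1 hn hreg hhist hfr m hnm hmN σ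
    have h3 : 0 ≤ R.Gfr 3 := gfr_nonneg_of_wf2 hR 3
    have hUle : U ≤ min (klEngU₀3 P R cc) (1 / (R.Gfr 3 + 1)) := by
      have h := hUu.trans (min_le_right _ _)
      rwa [abs_of_nonneg h3] at h
    exact hW G P R Q cc hR hcc hcc6 μ hμ U hU hUle β hβ hβc L M hL hM n hn1 hn hhist hfr m hnm hmN σ

end Summit.HubbardSuperconductivity.HubbardSuperconductivity.Theorems.EngineV8.A24a1G14

end
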